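import Literature.AnabelianGeometry.EtaleTheta.Discharge.Sec3Cor38iiOfInputsCanonical
import Literature.AnabelianGeometry.EtaleTheta.Discharge.Sec3Thm37Standard
import Literature.AlgebraicGeometry.Frobenioids.Cor411iiOfPreSteps
import Literature.AlgebraicGeometry.Frobenioids.Cor411iiiOfFSMType

/-!
# [EtTh] Corollary 3.8 (ii) — its input [FrdI] Cor. 4.11 (ii) DISCHARGED for tempered Frobenioids at the
# canonical vocabularies, and the node's closing theorem without it

Mochizuki, *The étale theta function …*, Publ. RIMS **45** (2009), Cor. 3.8 (ii), proof PDF p.81 l.17–20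
and l.33 – p.82 l.1: "[cf. … [Mzk17], Corollary 4.11, (ii)]" [cite: MochizukiEtTh2009, Cor 3.8 p.81]; [Mzk17] =
Mochizuki, *The geometry of Frobenioids I*, Kyushu J. Math. **62** (2008), Cor. 4.11 (ii) p.91 (hypotheses:
"`Φ_i` perf-factorial … `D_i` Div-slim … `C_i` of standard type"), proof pp.92–94
[cite: MochizukiFrdI2008, Cor. 4.11 (ii) p.91].  abc-iut cell, layer L2, cone node `EtTh:Cor3.8(ii)`, seat
abc-iut-w6-d040; proof-only sequel (0 definitions) of `Discharge/Sec3Cor38iiOfInputsCanonical.lean` (p431267),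
whose closing theorem `Cor38Hyp.cor38_ii_canonical` still takes [FrdI] Cor. 4.11 (ii) as the 0-ary named fact
`FrdI.Cor411ii` (cell FACT-LIST F-0715; per-instance form F-1026, conditional in L1).

FOR TEMPERED FROBENIOIDS THAT INPUT IS A THEOREM OF THE TREE.  L1 proves the typed Cor. 4.11 (ii)
`PreFrobenioidData.Cor411ii` for any pair of Frobenioids NOT of group-like type from "`Ψ`, `Ψ⁻¹` preserve
pre-steps" (the conclusion of [FrdI] Thm. 3.4 (ii)) modulo "`(C_i^istr)^pf` and `((C_i^istr)^pf)^birat` are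
Frobenioids" (abc-iut-L1-d6, `PreFrobenioid.cor411ii_of_preservesPreSteps_of_not_isOfGroupLikeType`,
`Cor411iiOfPreSteps.lean`), and discharges those two residuals from Prop. 3.2 (iii) and from "birationally
Frobenius-normalized type" (abc-iut-L1-t14, `isFrobenioid_perfection_istr`, `isFrobenioid_birat_perfection_istr`,
`Cor411iiiOfFSMType.lean`).  For the tempered Frobenioids of Cor. 3.8 at the canonical vocabularies
(`treeMonoidVocab`, `treeCatVocab`): `Φ_i` is perf-factorial (Def. 3.6 (ii), a field of the structure); `C_i` is
a Frobenioid and of birationally Frobenius-normalized type — [EtTh] Thm. 3.7 (i) via [FrdI] Thm. 5.2 (ii) —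
modulo `hBmon_i : IsMonoidOn C_i.ratFnFunctor` (abc-iut-L2-t3 `isFrobenioid_treeCatVocab_of_isMonoidOn`,
abc-iut-L6-t13/w4-d103 `isOfBiratFrobeniusNormalizedType_treeCatVocab`); `C_i` is not of group-like type
(Thm. 3.7 (i), C38-L01, abc-iut-w5-d135 `standardIsotropicNotGroupLike_treeCatVocab`); and `Ψ^{±1}` preserve
pre-steps (C38-L02a from the 0-ary fact `FrdI.Thm34ii`, `preservesPreSteps_of_fact`).  Hence:

* `Cor38Hyp.cor411ii_of_fact_treeCatVocab` / `…_symm_…` — the typed [FrdI] Cor. 4.11 (ii) for `Ψ` and for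
  `Ψ⁻¹`, from `h34 : FrdI.Thm34ii` (F-0711, proved in the tree) and `hBmon₁`, `hBmon₂` only;
* `Cor38Hyp.cor38_ii_canonical_of_thm34ii` — [EtTh] Cor. 3.8 (ii) AS TYPED (vocabulary parameter := [FrdI]
  Def. 4.5 (iv)) from: `h34` (F-0711, proved) · `hBmon₁`, `hBmon₂` · [EtTh] Rmk. 3.6.3 `hR₁`, `hR₂` (F-0581) ·
  the criterion C38-L05 at THE perfections `h5₁`, `h5₂` — Cor. 4.11 (ii) no longer an input.

HONEST FRAMING: refereed pre-IUT material ([EtTh] §3 over [FrdI] §§3–5); nothing here bears on [IUTchIII]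
Cor. 3.12; no side taken; typed ≠ proved — here proved modulo the displayed named binders.
-/

namespace Literature.AnabelianGeometry.EtaleTheta

open CategoryTheory Opposite Literature.AlgebraicGeometry.Frobenioids

universe u₀ v₀ u v w

namespace Cor38Hyp

variable {D₀ : Type u₀} [Category.{v₀} D₀] {D₀' : Type u₀} [Category.{v₀} D₀']
  {T : RealifiedDivisorMonoids (D₀ := D₀) treeMonoidVocab.{w}}
  {T' : RealifiedDivisorMonoids (D₀ := D₀') treeMonoidVocab.{w}}
  {D : Type u} [Category.{v} D] {D' : Type u} [Category.{v} D']
  {IsRational IsStrictlyRational : (Dᵒᵖ ⥤ CommMonCat.{w}) → Prop}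
  {IsRational' IsStrictlyRational' : (D'ᵒᵖ ⥤ CommMonCat.{w}) → Prop}
  {C₁ : TemperedFrobenioid T D (treeCatVocab D IsRational IsStrictlyRational)}
  {C₂ : TemperedFrobenioid T' D' (treeCatVocab D' IsRational' IsStrictlyRational')} (h : Cor38Hyp C₁ C₂)

/-- **[FrdI] Cor. 4.11 (ii) for the equivalence `Ψ : C₁ ⥲ C₂` of Cor. 3.8, a THEOREM at the canonical
vocabularies** (typed `PreFrobenioidData.Cor411ii` of the operations of the two tempered Frobenioids): from the
0-ary fact [FrdI] Thm. 3.4 (ii) (`h34`, F-0711 — proved in the tree, `FrdI.Thm34ii_holds`) and "`𝔹_i` is a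
monoid on `D_i`" (`hBmon_i`), along abc-iut-L1-d6's `cor411ii_of_preservesPreSteps_of_not_isOfGroupLikeType`
(its residuals "`(C_i^istr)^pf`, `((C_i^istr)^pf)^birat` are Frobenioids" discharged by abc-iut-L1-t14's lemmas,
the latter through Thm. 3.7 (i) "birationally Frobenius-normalized"). [cite: MochizukiFrdI2008, Cor. 4.11 (ii) p.91] -/
theorem cor411ii_of_fact_treeCatVocab (h34 : FrdI.Thm34ii.{w, v, max v w, u, max u w})
    (hBmon₁ : IsMonoidOn C₁.ratFnFunctor) (hBmon₂ : IsMonoidOn C₂.ratFnFunctor) :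
    C₁.opsData.Cor411ii C₂.opsData h.Ψ := by
  have hF₁ := C₁.isFrobenioid_treeCatVocab_of_isMonoidOn hBmon₁
  have hF₂ := C₂.isFrobenioid_treeCatVocab_of_isMonoidOn hBmon₂
  have H := h.standardIsotropicNotGroupLike_treeCatVocab hBmon₁ hBmon₂
  have hps := h.preservesPreSteps_of_fact h34 hF₁ hF₂ H
  have hPf₁ := PreFrobenioid.isFrobenioid_perfection_istr hF₁
  have hPf₂ := PreFrobenioid.isFrobenioid_perfection_istr hF₂
  exact PreFrobenioid.cor411ii_of_preservesPreSteps_of_not_isOfGroupLikeType hF₁ hF₂ h.Ψ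
    (fun X => C₁.isPerfFactorial (op X)) (fun X => C₂.isPerfFactorial (op X)) hps.1 hps.2
    H.notGroupLike.1 H.notGroupLike.2 hPf₁ hPf₂
    (PreFrobenioid.isFrobenioid_birat_perfection_istr hF₁
      (C₁.isOfBiratFrobeniusNormalizedType_treeCatVocab hBmon₁) hPf₁)
    (PreFrobenioid.isFrobenioid_birat_perfection_istr hF₂
      (C₂.isOfBiratFrobeniusNormalizedType_treeCatVocab hBmon₂) hPf₂)

/-- **[FrdI] Cor. 4.11 (ii) for `Ψ⁻¹`**, likewise a theorem at the canonical vocabularies.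
[cite: MochizukiFrdI2008, Cor. 4.11 (ii) p.91] -/
theorem cor411ii_symm_of_fact_treeCatVocab (h34 : FrdI.Thm34ii.{w, v, max v w, u, max u w})
    (hBmon₁ : IsMonoidOn C₁.ratFnFunctor) (hBmon₂ : IsMonoidOn C₂.ratFnFunctor) :
    C₂.opsData.Cor411ii C₁.opsData h.Ψ.symm := by
  have hF₁ := C₁.isFrobenioid_treeCatVocab_of_isMonoidOn hBmon₁
  have hF₂ := C₂.isFrobenioid_treeCatVocab_of_isMonoidOn hBmon₂
  have H := h.standardIsotropicNotGroupLike_treeCatVocab hBmon₁ hBmon₂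
  have hps := h.preservesPreSteps_of_fact h34 hF₁ hF₂ H
  have hPf₁ := PreFrobenioid.isFrobenioid_perfection_istr hF₁
  have hPf₂ := PreFrobenioid.isFrobenioid_perfection_istr hF₂
  exact PreFrobenioid.cor411ii_of_preservesPreSteps_of_not_isOfGroupLikeType hF₂ hF₁ h.Ψ.symm
    (fun X => C₂.isPerfFactorial (op X)) (fun X => C₁.isPerfFactorial (op X)) hps.2 hps.1
    H.notGroupLike.2 H.notGroupLike.1 hPf₂ hPf₁
    (PreFrobenioid.isFrobenioid_birat_perfection_istr hF₂
      (C₂.isOfBiratFrobeniusNormalizedType_treeCatVocab hBmon₂) hPf₂)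
    (PreFrobenioid.isFrobenioid_birat_perfection_istr hF₁
      (C₁.isOfBiratFrobeniusNormalizedType_treeCatVocab hBmon₁) hPf₁)

/-- **[EtTh] Cor. 3.8 (ii) AS TYPED at the canonical vocabularies, [FrdI] Cor. 4.11 (ii) no longer an
input** (abc-iut-L2-t3's `Cor38_ii`, vocabulary parameter := [FrdI] Def. 4.5 (iv) read on `(E, Φ)`): the node
`EtTh:Cor3.8(ii)` closed modulo `h34` ([FrdI] Thm. 3.4 (ii), F-0711, PROVED in the tree: `FrdI.Thm34ii_holds`),
`hBmon₁`, `hBmon₂` ("`𝔹_i` is a monoid on `D_i`"), [EtTh] Rmk. 3.6.3 `hR₁`, `hR₂` (F-0581) and the criterion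
C38-L05 at THE perfections `h5₁`, `h5₂`. [cite: MochizukiEtTh2009, Cor 3.8 p.81] -/
theorem cor38_ii_canonical_of_thm34ii (h34 : FrdI.Thm34ii.{w, v, max v w, u, max u w})
    (hBmon₁ : IsMonoidOn C₁.ratFnFunctor) (hBmon₂ : IsMonoidOn C₂.ratFnFunctor)
    (hR₁ : C₁.Remark363) (hR₂ : C₂.Remark363)
    (h5₁ : C₁.BsFldPreStepLimitCriterion
      (PreFrobenioidData.perfection (C₁.isFrobenioid_treeCatVocab_of_isMonoidOn hBmon₁)))
    (h5₂ : C₂.BsFldPreStepLimitCriterion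
      (PreFrobenioidData.perfection (C₂.isFrobenioid_treeCatVocab_of_isMonoidOn hBmon₂))) :
    Literature.AnabelianGeometry.EtaleTheta.Cor38_ii
      (fun E _ Φ => ∀ (A : E) (α : Aut (Over.forget A)),
        (∀ (B : Over A) (x : Φ.obj (op B.left)),
          Literature.AlgebraicGeometry.Frobenioids.pull Φ (α.hom.app B) x = x) → α = 1) h :=
  h.cor38_ii_of_criterion _ (fun hd => ⟨hd⟩) (fun hd' => ⟨hd'⟩) h34 _ _
    (h.standardIsotropicNotGroupLike_treeCatVocab hBmon₁ hBmon₂) (h.cor411ii_of_fact_treeCatVocab h34 hBmon₁ hBmon₂)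
    (h.cor411ii_symm_of_fact_treeCatVocab h34 hBmon₁ hBmon₂) h5₁ h5₂ hR₁ hR₂ C₁.hullEssImageObjClause_holds
    C₂.hullEssImageObjClause_holds

end Cor38Hyp

end Literature.AnabelianGeometry.EtaleTheta
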